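import Mathlib
import HarnessLib.Audit
import Summits.PneNP.PneNP.Theorems.PstarSliceGenericCriterion

/-!
# Short coincidences live on the skeleton: a chord with a clean endpoint passes branch (B) (ROUND-24, O1; memo g23 §28)

FRONTIER range-avoidance ladder, rung F-N3, ROUND 24 (cell `pnp-ideate`, prover-2 memo `g23/O1-TWOCLEAN-g23.md` §28; typed target
`PstarCoreBoundTargets.TerminalPeelable` (p646951); restricted-model proof complexity — nothing here bears on `P` versus `NP`).

The `k`-independent half of the planner's skeleton argument for branch (B) (`PstarSliceGenericCriterion.NoShortCoincidence`): a short coincidence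
`F₁` at the chord `c` makes `c + F₁` everywhere even, so EACH XOR endpoint of `c` carries an output of `F₁` — an output of `J₀ ∖ c` that is NOT an
outside-gated chord.  Hence:

* `exists_mem_through_endpoint` — in the data of a short coincidence, through each XOR endpoint of `c` passes a member of `F₁`;
* **`noShortCoincidence_of_clean_endpoint`** — if every output of `J₀ ∖ c` reading the XOR variable `vars c s` (`s ∈ {0,1}`) is an outside-gated
  chord, then `NoShortCoincidence I J₀ c 𝒢` holds.  So the chords that can fail (B) have BOTH XOR endpoints among the XOR vertices of the non-clean
  outputs (non-chords and dirty chords) — a set that does not grow with the number of clean chords.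

No Assumption A.
-/

set_option linter.dupNamespace false -- `Summit.PneNP.PneNP.…`: summit = sub-problem name (D-0017 single-conjunct layout)

open Finset Literature.Computability.Complexity
open Summit.PneNP.PneNP.Theorems.PstarTyped (Typed)
open Summit.PneNP.PneNP.Theorems.PstarSALevel (varSet bdry)
open Summit.PneNP.PneNP.Theorems.PstarCentreFree (vars_mem_varSet)
open Summit.PneNP.PneNP.Theorems.PstarChordRepair (IsChord)
open Summit.PneNP.PneNP.Theorems.PstarChordBridgeTools (xpdeg)
open Summit.PneNP.PneNP.Theorems.PstarChordBridgeFundamental (xpdeg_insert)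
open Summit.PneNP.PneNP.Theorems.PstarPairCoreNormal (exists_xor_slot_of_odd)
open Summit.PneNP.PneNP.Theorems.PstarChordReadOutside (OutsideGated)
open Summit.PneNP.PneNP.Theorems.PstarSliceGenericCriterion (NoShortCoincidence)

namespace Summit.PneNP.PneNP.Theorems.PstarShortCoincidenceEndpoints

variable {n m : ℕ} {I : LocalMap 4 n m} {J₀ 𝒢 F₁ : Finset (Fin m)} {c : Fin m}

/-- **Through each XOR endpoint of `c` passes a member of `F₁`** whenever `c ∉ F₁` and `c + F₁` is everywhere even. -/
theorem exists_mem_through_endpoint (hI : I.IsPure xorAndPred) (hcF : c ∉ F₁) (heven : ∀ v, Even (xpdeg I (insert c F₁) v))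
    {s : Fin 4} (hs : s.val < 2) : ∃ f ∈ F₁, ∃ s' : Fin 4, s'.val < 2 ∧ I.vars f s' = I.vars c s := by
  have h01 : I.vars c 0 ≠ I.vars c 1 := fun h => absurd (hI.2 c h) (by decide)
  have hs01 : s = 0 ∨ s = 1 := by
    have h4 : ∀ t : Fin 4, t.val < 2 → t = 0 ∨ t = 1 := by decide
    exact h4 s hs
  refine exists_xor_slot_of_odd ?_
  have h := heven (I.vars c s)
  rw [xpdeg_insert I hcF] at h
  rcases hs01 with rfl | rfl
  · rw [if_pos rfl, if_neg h01.symm] at h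
    rcases Nat.even_or_odd (xpdeg I F₁ (I.vars c 0)) with he | ho
    · exfalso
      obtain ⟨k, hk⟩ := he
      obtain ⟨k', hk'⟩ := h
      omega
    · exact ho
  · rw [if_neg h01, if_pos rfl] at h
    rcases Nat.even_or_odd (xpdeg I F₁ (I.vars c 1)) with he | ho
    · exfalso
      obtain ⟨k, hk⟩ := he
      obtain ⟨k', hk'⟩ := h
      omega
    · exact ho

/-- **A CHORD WITH A CLEAN ENDPOINT PASSES BRANCH (B).**  If every output of `J₀ ∖ c` reading the XOR variable `vars c s` is an outside-gated chord
of `J₀` (menu `𝒢`), then there is no short coincidence at `c`. -/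
theorem noShortCoincidence_of_clean_endpoint (hI : I.IsPure xorAndPred) {s : Fin 4} (hs : s.val < 2)
    (hclean : ∀ f ∈ J₀.erase c, I.vars c s ∈ varSet I f → IsChord I J₀ f ∧ OutsideGated I J₀ 𝒢 f) : NoShortCoincidence I J₀ c 𝒢 := by
  intro F₁ hF₁ _ hnoclean heven _ _
  have hcF : c ∉ F₁ := fun h => (mem_erase.1 (hF₁ h)).1 rfl
  obtain ⟨f, hf, s', -, hfs⟩ := exists_mem_through_endpoint hI hcF heven hs
  have hread : I.vars c s ∈ varSet I f := hfs ▸ vars_mem_varSet I f s'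
  obtain ⟨hch, hO⟩ := hclean f (hF₁ hf) hread
  exact hnoclean f hf hch hO

end Summit.PneNP.PneNP.Theorems.PstarShortCoincidenceEndpoints
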